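import Summits.HubbardSuperconductivity.HubbardSuperconductivity.Theorems.SoloBlindPlaquettePatterns
import Summits.HubbardSuperconductivity.HubbardSuperconductivity.Theorems.SoloBlindPlaquetteGeometry
import HarnessLib

/-!
# Plaquette-weighted bond estimates (Theorem 42, part 4/5)

Solo-blind programme `HubbardSuperconductivity`, generation 55.  The occupation-basis bond estimate
of `SoloBlindMottFloor` with a FREE weight on hole hops, and its specialisation to the plaquette
weights of `SoloBlindPlaquetteGeometry`.

* `norm_hop_le_weighted` — `|⟨ψ, c†_a c_b ψ⟩| ≤ Σ_s |ψ(s)|² ([a ∈ s, b ∉ s] w_A(s) + [b ∈ s, a ∉ s] w_B(s))`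
  for any configuration-dependent weights with `w_A ≥ 0`, `4 w_A(u ∪ a) w_B(u ∪ b) ≥ 1` on linked
  pairs: the hole-hop part of the kinetic energy is a sign-free adjacency on configurations, so
  the AM–GM split may be weighted freely (Theorem 34′ is `w ≡ ½`).
* `W`, `norm_bond_le_w`, `sum_W_le` — the Hubbard bond term with the doublon classes weighted as in
  Theorem 34′ (`½`, `α`, `β`, `4αβ = 1`) and a free hole-hop weight `w`; summed over the spin,
  a configuration receives `(½ + 2α)` per doubly occupied end, `2β`, and `w(s)` if exactly one end
  is empty.
* `site`, `pat`, `pw` — corners of a plaquette, the emptiness pattern of a configuration on it and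
  the plaquette weight `wt ∘ pat`; `pw_admissible` — along a local bond the two sides of a hole hop
  carry the patterns `hopA`/`hopB`, so `1 ≤ 4·pw·pw'`; `sum_local_W_le` — the sixteen bond terms of
  one plaquette charge a configuration at most `(2 + 8α)·#(doubly occupied corners) + 16β + wt·mixed`.

[this work]
-/

noncomputable section

namespace Summit.HubbardSuperconductivity.HubbardSuperconductivity.Theorems.PlaquetteMottFloor

open Matrix Finset Literature.Probability.LatticeModels Literature.MathematicalPhysics.QuantumLattice
  Literature.MathematicalPhysics.QuantumLattice.EigenvalueContinuation
  Summit.HubbardSuperconductivity.HubbardSuperconductivity.Theorems.MottFloor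
open scoped ComplexOrder ComplexConjugate

/-! ### A weighted occupation-basis bound for one hopping term -/

section Generic

variable {ι : Type*} [LinearOrder ι] [Fintype ι]

/-- Weighted AM–GM: `AB ≤ a A² + b B²` whenever `a ≥ 0` and `4ab ≥ 1`. [folklore] -/
theorem mul_le_of_one_le_four_mul {a b A B : ℝ} (ha : 0 ≤ a) (hab : 1 ≤ 4 * a * b) :
    A * B ≤ a * A ^ 2 + b * B ^ 2 := by
  have ha' : 0 < a := by
    rcases ha.eq_or_lt with h | h
    · rw [← h] at hab; norm_num at hab
    · exact h
  have h1 : 0 ≤ (4 * a * b - 1) * B ^ 2 := mul_nonneg (by linarith) (sq_nonneg B)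
  have e : 4 * a * (a * A ^ 2 + b * B ^ 2 - A * B) = (2 * a * A - B) ^ 2 + (4 * a * b - 1) * B ^ 2 := by
    ring
  have key : 0 ≤ 4 * a * (a * A ^ 2 + b * B ^ 2 - A * B) := by
    rw [e]; exact add_nonneg (sq_nonneg _) h1
  have : 0 ≤ a * A ^ 2 + b * B ^ 2 - A * B := by
    by_contra hneg
    have : 4 * a * (a * A ^ 2 + b * B ^ 2 - A * B) < 0 :=
      mul_neg_of_pos_of_neg (by positivity) (not_le.mp hneg)
    linarith
  linarith

/-- **Weighted hopping bound**: for configuration-dependent weights `w_A, w_B ≥ 0` with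
`4 w_A(u ∪ a) w_B(u ∪ b) ≥ 1` on every pair of configurations linked by the hop,
`|⟨ψ, c†_a c_b ψ⟩| ≤ Σ_s |ψ(s)|² ([a ∈ s, b ∉ s] w_A(s) + [b ∈ s, a ∉ s] w_B(s))`. [this work] -/
theorem norm_hop_le_weighted (a b : ι) (hab : a ≠ b) (ψ : Fock ι) (wA wB : Finset ι → ℝ)
    (hw : ∀ u : Finset ι, a ∉ u → b ∉ u →
      0 ≤ wA (insert a u) ∧ 1 ≤ 4 * wA (insert a u) * wB (insert b u)) :
    ‖star ψ ⬝ᵥ ((creation a * annihilation b) *ᵥ ψ)‖ ≤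
      ∑ s, ‖ψ s‖ ^ 2 * ((if a ∈ s ∧ b ∉ s then wA s else 0) + (if b ∈ s ∧ a ∉ s then wB s else 0)) := by
  refine (norm_hop_le a b ψ).trans ?_
  have step1 : ∀ u : Finset ι,
      (if a ∉ u ∧ b ∉ u then ‖ψ (insert a u)‖ * ‖ψ (insert b u)‖ else 0) ≤
        (if a ∉ u ∧ b ∉ u then wA (insert a u) * ‖ψ (insert a u)‖ ^ 2 else 0) +
          (if b ∉ u ∧ a ∉ u then wB (insert b u) * ‖ψ (insert b u)‖ ^ 2 else 0) := by
    intro u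
    by_cases h : a ∉ u ∧ b ∉ u
    · rw [if_pos h, if_pos h, if_pos h.symm]
      obtain ⟨h0, h1⟩ := hw u h.1 h.2
      exact mul_le_of_one_le_four_mul h0 h1
    · rw [if_neg h, if_neg h, if_neg (fun h' => h h'.symm), add_zero]
  refine (Finset.sum_le_sum fun u _ => step1 u).trans (le_of_eq ?_)
  have hA := sum_ite_insert a (fun u => b ∉ u) (fun s => wA s * ‖ψ s‖ ^ 2)
  have hB := sum_ite_insert b (fun u => a ∉ u) (fun s => wB s * ‖ψ s‖ ^ 2)
  rw [Finset.sum_add_distrib, hA, hB, ← Finset.sum_add_distrib]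
  refine Finset.sum_congr rfl fun s _ => ?_
  simp only [Finset.mem_erase, ne_eq, hab, hab.symm, not_false_eq_true, true_and]
  split_ifs <;> ring

end Generic

/-! ### The Hubbard bond term -/

variable {L : ℕ} [NeZero L]

omit [NeZero L] in
/-- **Bond estimate with a free hole-hop weight**: `|⟨ψ, c†_{xσ} c_{yσ} ψ⟩| ≤ Σ_s |ψ(s)|² W_s(x,y,σ)`
for `x ≠ y`, provided the hole-hop weight satisfies `w ≥ 0`, `4 w(s) w(s') ≥ 1` on the two sides of
every hole hop along `(x,y)`. [this work] -/
theorem norm_bond_le_w {α β : ℝ} (hα : 0 < α) (hαβ : 4 * α * β = 1)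
    (w : Finset (Orb (FermionTorus 2 L)) → ℝ) (ψ : Fock (Orb (FermionTorus 2 L)))
    {x y : FermionTorus 2 L} (hxy : x ≠ y) (σ : Fin 2)
    (hw : ∀ u : Finset (Orb (FermionTorus 2 L)), orb x σ ∉ u → orb y σ ∉ u →
      orb x (1 - σ) ∉ u → orb y (1 - σ) ∉ u →
      0 ≤ w (insert (orb x σ) u) ∧ 1 ≤ 4 * w (insert (orb x σ) u) * w (insert (orb y σ) u)) :
    ‖star ψ ⬝ᵥ ((creation (orb x σ) * annihilation (orb y σ)) *ᵥ ψ)‖ ≤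
      ∑ s, ‖ψ s‖ ^ 2 * W α β w s x y σ := by
  have hσ : (1 - σ) ≠ σ := by fin_cases σ <;> decide
  have hab : orb x σ ≠ orb y σ := fun h => hxy (orb_inj.1 h).1
  have ha'a : orb x (1 - σ) ≠ orb x σ := fun h => hσ (orb_inj.1 h).2
  have hb'a : orb y (1 - σ) ≠ orb x σ := fun h => hxy (orb_inj.1 h).1.symm
  have ha'b : orb x (1 - σ) ≠ orb y σ := fun h => hxy (orb_inj.1 h).1
  have hb'b : orb y (1 - σ) ≠ orb y σ := fun h => hσ (orb_inj.1 h).2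
  have hβ : 0 ≤ β := by
    have : 0 < 4 * α * β := by rw [hαβ]; exact one_pos
    nlinarith
  refine norm_hop_le_weighted (orb x σ) (orb y σ) hab ψ (wA α β w x y σ) (wB α β w x y σ) ?_
  intro u ha hb
  simp only [wA, wB, Finset.mem_insert, ha'a, hb'a, ha'b, hb'b, false_or]
  by_cases p : orb x (1 - σ) ∈ u <;> by_cases q : orb y (1 - σ) ∈ u <;>
    simp only [p, q, if_true, if_false]
  · norm_num
  · exact ⟨hα.le, hαβ.symm.le⟩
  · exact ⟨hβ, le_of_eq (by rw [← hαβ]; ring)⟩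
  · convert hw u ha hb p q

omit [NeZero L] in
/-- **Summing the two spins**: `Σ_σ W_s(x,y,σ) ≤ (½ + 2α)([x dbl] + [y dbl]) + 2β + [mixed] w(s)`,
where *mixed* means that exactly one of `x`, `y` is empty. [this work] -/
theorem sum_W_le {α β : ℝ} (hα : 0 ≤ α) (hβ : 0 ≤ β) {w : Finset (Orb (FermionTorus 2 L)) → ℝ}
    (s : Finset (Orb (FermionTorus 2 L))) (hw : 0 ≤ w s) (x y : FermionTorus 2 L) :
    ∑ σ, W α β w s x y σ ≤
      (if IsDbl s x then 1 / 2 + 2 * α else 0) + (if IsDbl s y then 1 / 2 + 2 * α else 0) + 2 * β +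
        (if (IsEmp s x ∧ ¬ IsEmp s y) ∨ (¬ IsEmp s x ∧ IsEmp s y) then w s else 0) := by
  rw [Fin.sum_univ_two]
  simp only [W, wA, wB, Fin.isValue, sub_zero, sub_self, IsEmp, IsDbl]
  by_cases h1 : orb x 0 ∈ s <;> by_cases h2 : orb x 1 ∈ s <;> by_cases h3 : orb y 0 ∈ s <;>
    by_cases h4 : orb y 1 ∈ s <;> simp [h1, h2, h3, h4] <;> linarith

/-! ### Plaquette weights along local bonds -/

/-- `ofTorusSite` is injective. [folklore] -/
private theorem ofTorusSite_inj {a b : TorusSite 2 L}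
    (h : FermionTorus.ofTorusSite a = FermionTorus.ofTorusSite b) : a = b := by
  have := congrArg FermionTorus.toTorusSite h
  rwa [FermionTorus.toTorusSite_ofTorusSite, FermionTorus.toTorusSite_ofTorusSite] at this

/-- Distinct corners are distinct sites (`L > 1`). [folklore] -/
theorem site_ne (hL : 1 < L) (k : TorusSite 2 L) {c c' : Fin 4} (h : c ≠ c') :
    site k c ≠ site k c' := by
  intro e
  exact h (off_injective hL (add_left_cancel (ofTorusSite_inj e)))

/-- **The hole hop seen by the plaquette**: inserting an electron at the source corner of a local
bond into a configuration in which both ends are free turns the pattern into `hopA`. [this work] -/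
theorem pat_insert_src (hL : 1 < L) (k : TorusSite 2 L) (i : Fin 4 × Bool) (σ : Fin 2)
    (u : Finset (Orb (FermionTorus 2 L)))
    (hy0 : orb (site k (dst i)) 0 ∉ u) (hy1 : orb (site k (dst i)) 1 ∉ u) :
    pat k (insert (orb (site k (src i)) σ) u) = hopA (pat k u) i := by
  funext c
  simp only [pat, hopA]
  by_cases hd : c = dst i
  · subst hd
    rw [Function.update_self]
    have hne : site k (dst i) ≠ site k (src i) := site_ne hL k (src_ne_dst i).symm
    have h0 : orb (site k (dst i)) 0 ≠ orb (site k (src i)) σ := fun h => hne (orb_inj.1 h).1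
    have h1 : orb (site k (dst i)) 1 ≠ orb (site k (src i)) σ := fun h => hne (orb_inj.1 h).1
    simp [IsEmp, Finset.mem_insert, h0, h1, hy0, hy1]
  · rw [Function.update_of_ne hd]
    by_cases hs : c = src i
    · subst hs
      rw [Function.update_self]
      fin_cases σ <;> simp [IsEmp]
    · rw [Function.update_of_ne hs]
      have hne : site k c ≠ site k (src i) := site_ne hL k hs
      have h0 : orb (site k c) 0 ≠ orb (site k (src i)) σ := fun h => hne (orb_inj.1 h).1
      have h1 : orb (site k c) 1 ≠ orb (site k (src i)) σ := fun h => hne (orb_inj.1 h).1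
      simp [pat, IsEmp, Finset.mem_insert, h0, h1]

/-- The mirror statement for the target corner: the pattern becomes `hopB`. [this work] -/
theorem pat_insert_dst (hL : 1 < L) (k : TorusSite 2 L) (i : Fin 4 × Bool) (σ : Fin 2)
    (u : Finset (Orb (FermionTorus 2 L)))
    (hx0 : orb (site k (src i)) 0 ∉ u) (hx1 : orb (site k (src i)) 1 ∉ u) :
    pat k (insert (orb (site k (dst i)) σ) u) = hopB (pat k u) i := by
  funext c
  simp only [pat, hopB]
  by_cases hd : c = dst i
  · subst hd
    rw [Function.update_self]
    fin_cases σ <;> simp [IsEmp]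
  · rw [Function.update_of_ne hd]
    by_cases hs : c = src i
    · subst hs
      rw [Function.update_self]
      have hne : site k (src i) ≠ site k (dst i) := site_ne hL k (src_ne_dst i)
      have h0 : orb (site k (src i)) 0 ≠ orb (site k (dst i)) σ := fun h => hne (orb_inj.1 h).1
      have h1 : orb (site k (src i)) 1 ≠ orb (site k (dst i)) σ := fun h => hne (orb_inj.1 h).1
      simp [IsEmp, Finset.mem_insert, h0, h1, hx0, hx1]
    · rw [Function.update_of_ne hs]
      have hne : site k c ≠ site k (dst i) := site_ne hL k hd
      have h0 : orb (site k c) 0 ≠ orb (site k (dst i)) σ := fun h => hne (orb_inj.1 h).1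
      have h1 : orb (site k c) 1 ≠ orb (site k (dst i)) σ := fun h => hne (orb_inj.1 h).1
      simp [pat, IsEmp, Finset.mem_insert, h0, h1]

/-- **Admissibility of the plaquette weights** along every local bond of the plaquette. [this work] -/
theorem pw_admissible (hL : 1 < L) (k : TorusSite 2 L) (i : Fin 4 × Bool) (σ : Fin 2)
    (u : Finset (Orb (FermionTorus 2 L)))
    (hxσ : orb (site k (src i)) σ ∉ u) (hyσ : orb (site k (dst i)) σ ∉ u)
    (hx' : orb (site k (src i)) (1 - σ) ∉ u) (hy' : orb (site k (dst i)) (1 - σ) ∉ u) :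
    0 ≤ pw k (insert (orb (site k (src i)) σ) u) ∧
      1 ≤ 4 * pw k (insert (orb (site k (src i)) σ) u) * pw k (insert (orb (site k (dst i)) σ) u) := by
  have hx0 : orb (site k (src i)) 0 ∉ u := by fin_cases σ <;> assumption
  have hx1 : orb (site k (src i)) 1 ∉ u := by fin_cases σ <;> assumption
  have hy0 : orb (site k (dst i)) 0 ∉ u := by fin_cases σ <;> assumption
  have hy1 : orb (site k (dst i)) 1 ∉ u := by fin_cases σ <;> assumption
  simp only [pw, pat_insert_src hL k i σ u hy0 hy1, pat_insert_dst hL k i σ u hx0 hx1]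
  exact ⟨(wt_pos _).le, one_le_four_mul_wt_hop _ _⟩

/-- The *mixed* indicator of a local bond is the inequality of the pattern bits. [folklore] -/
theorem mixed_iff (k : TorusSite 2 L) (s : Finset (Orb (FermionTorus 2 L))) (i : Fin 4 × Bool) :
    ((IsEmp s (site k (src i)) ∧ ¬ IsEmp s (site k (dst i))) ∨
        (¬ IsEmp s (site k (src i)) ∧ IsEmp s (site k (dst i)))) ↔
      pat k s (src i) ≠ pat k s (dst i) := by
  simp only [pat]
  by_cases hP : IsEmp s (site k (src i)) <;> by_cases hQ : IsEmp s (site k (dst i)) <;>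
    simp [hP, hQ] <;> assumption

/-- **Charge of one plaquette**: the weight a configuration receives from the sixteen bond terms of a
plaquette is at most `(2 + 8α)·#(doubly occupied corners) + 16β + wt·mixed`. [this work] -/
theorem sum_local_W_le {α β : ℝ} (hα : 0 ≤ α) (hβ : 0 ≤ β) (k : TorusSite 2 L)
    (s : Finset (Orb (FermionTorus 2 L))) :
    ∑ i : Fin 4 × Bool, ∑ σ, W α β (pw k) s (site k (src i)) (site k (dst i)) σ ≤
      (2 + 8 * α) * ∑ c : Fin 4, (if IsDbl s (site k c) then (1 : ℝ) else 0) + 16 * β +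
        wt (pat k s) * (mixed (pat k s) : ℝ) := by
  set g : Fin 4 → ℝ := fun c => if IsDbl s (site k c) then 1 / 2 + 2 * α else 0 with hg
  have h1 : ∀ i : Fin 4 × Bool, ∑ σ, W α β (pw k) s (site k (src i)) (site k (dst i)) σ ≤
      (g (src i) + g (dst i)) + 2 * β +
        (if pat k s (src i) ≠ pat k s (dst i) then pw k s else 0) := by
    intro i
    have h := sum_W_le hα hβ (w := pw k) s (wt_pos _).le (site k (src i)) (site k (dst i))
    rw [if_congr (mixed_iff k s i) rfl rfl] at h
    simpa only [hg] using h
  refine (Finset.sum_le_sum fun i _ => h1 i).trans ?_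
  rw [Finset.sum_add_distrib, Finset.sum_add_distrib, sum_src_add_dst, sum_ite_mixed, Finset.sum_const,
    Finset.card_univ]
  have hcard : Fintype.card (Fin 4 × Bool) = 8 := by simp
  rw [hcard, nsmul_eq_mul]
  have hgsum : ∑ c, g c = (1 / 2 + 2 * α) * ∑ c : Fin 4, (if IsDbl s (site k c) then (1 : ℝ) else 0) := by
    rw [Finset.mul_sum]
    refine Finset.sum_congr rfl fun c _ => ?_
    simp only [hg]; split_ifs <;> ring
  rw [hgsum, pw]
  push_cast
  nlinarith [Finset.sum_nonneg (fun c (_ : c ∈ (univ : Finset (Fin 4))) =>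
    (show (0 : ℝ) ≤ (if IsDbl s (site k c) then (1 : ℝ) else 0) by split_ifs <;> norm_num))]

end Summit.HubbardSuperconductivity.HubbardSuperconductivity.Theorems.PlaquetteMottFloor
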